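/-
Origin: expansion seat `planner-pub-hodgecm-toy2-g5-0`, handover #3 2026-08-18T08:46:35Z (`HOME/pub-hodgecm-toy2-g5/lean/Toy2g5/ToyPadH0J.lean`, md5 b0dad365, 134 lines);
landed by the gen-7 packager in gate run 27 as `HodgeCM/Model/Toy/ToyPadH0J.lean` (import ^import Toy2g5\.PadH0J\b→import HodgeCM.Model.PadH0J ×1; stripped 2 #print/#check/#eval lines).
-/
/-
Copyright: pub-hodgecm formalisation cell (harness21, 2026). New file (not vendored).
Origin: HOME/pub-hodgecm-toy2-g5/lean/Toy2g5/ToyPadH0J.lean — session planner-pub-hodgecm-toy2-g5-0 (unit pub-hodgecm-toy2-g5,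
CONSISTENCY seat 2, part (6a)(ii), generation 5).  WIP module `Toy2g5.ToyPadH0J`; intended final place
`HodgeCM/Model/Toy/ToyPadH0J.lean` (module `HodgeCM.Model.Toy.ToyPadH0J`).  ONE import to rewrite on landing:
`Toy2g5.PadH0J` ↦ `HodgeCM.Model.PadH0J`.
-/
import Summits.HodgeConjecture.HodgeCM.Model.PadH0J
import Summits.HodgeConjecture.HodgeCM.Model.Toy.H0Rank
import Summits.HodgeConjecture.HodgeCM.Model.Toy.ToyGysinDescent
import Summits.HodgeConjecture.HodgeCM.Model.Toy.ToyFFacts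
import Summits.HodgeConjecture.HodgeCM.Model.Toy.ToyOpenInputs
import Summits.HodgeConjecture.HodgeCM.Model.ToyPerL

/-!
# N4 `Fact_hodge_F0` is independent: the model `toyModel♭ᴶ`

`jPadModel := toyModel.padH0 toyModel.padDatumJ` (`HodgeCM.Model.PadH0J` applied to the exterior toy universe
`HodgeCM.Toy.toyModel`, in which `H⁰(X, ℚ) = ⋀⁰ L_X = ℚ ≠ 0` for every object).  Truth table (each row a theorem below or
in the files cited):

| statement                                   | `toyModel` | `jPadModel` |
|---------------------------------------------|:----------:|:-----------:|
| `ModelAxioms` (M1–M28)                      | true       | true        |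
| N1 `Fact_cupExterior`, N2 `Fact_cup_hodge`  | true       | true        |
| N3 `Fact_pull_H0`                           | true       | true        |
| **N4 `Fact_hodge_F0`**                      | true       | **false**   |
| F4 `Fact_cupAlg`, F5 `Fact_cupAssoc`        | true       | true        |
| `Fact_dimProd`, `W_RK4`                     | true       | true        |
| `PohlmannSpan`, `HC_CM`                     | true       | true        |
| M30 `Fact_weightHodge`                      | true       | **false**   |

Headline: `HodgeCM.Toy.fact_hodge_F0_independent` — N4 is independent of
`ModelAxioms ∧ N1 ∧ N2 ∧ N3 ∧ F4 ∧ F5 ∧ Fact_dimProd ∧ W_RK4 ∧ PohlmannSpan ∧ HC_CM` (both truth values realised), and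
`HodgeCM.Toy.not_fact_weightHodge_of_others` — M30 does not follow from that conjunction either (N4 is the load-bearing
input of the degree-`0` case of `weightHodge_of_facts`).  Nothing is cited; Lean + Mathlib axioms only.
-/

noncomputable section

namespace HodgeCM.Toy

open Literature.AlgebraicGeometry.Motives (CMType)
open Universe

/-- **The slope-padded toy universe** `toyModel♭ᴶ`: `H⁰ ↦ H⁰ ⊕ (H⁰ ⊕ H⁰)`, the pad of type `(1,-1) + (-1,1)`. -/
def jPadModel : Universe := toyModel.padH0 toyModel.padDatumJ

/-- (Ported verbatim from the HodgeCMPerL package; no docstring in the source.) -/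
theorem jPadModel_def : jPadModel = toyModel.padH0 toyModel.padDatumJ := rfl

/-- Some `H⁰(A′, ℚ) ≠ 0` in the toy universe (all of them are `ℚ`). -/
theorem toyModel_exists_cmProd_H0_nontrivial :
    ∃ (F : CMField) (n : ℕ) (Θ : Fin (n + 1) → CMType F), Nontrivial (toyModel.Coh (toyModel.cmProd F Θ) 0) := by
  obtain ⟨F, -, -, f, -, -⟩ := faceHypothesesInhabited
  exact ⟨F, 0, fun _ => f.Φ, cmProdH0Nontrivial exteriorHodgeData F 0 _⟩

/-- (Ported verbatim from the HodgeCMPerL package; no docstring in the source.) -/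
theorem jPadModel_modelAxioms : jPadModel.ModelAxioms := PadH0J.modelAxioms toyModel_modelAxioms toyModel_fact_dimProd

/-- (Ported verbatim from the HodgeCMPerL package; no docstring in the source.) -/
theorem jPadModel_fact_cupExterior : jPadModel.Fact_cupExterior :=
  PadH0.fact_cupExterior_iff.mpr toyModel_fact_cupExterior

/-- (Ported verbatim from the HodgeCMPerL package; no docstring in the source.) -/
theorem jPadModel_fact_cup_hodge : jPadModel.Fact_cup_hodge := PadH0.fact_cup_hodge toyModel_fact_cup_hodge

/-- (Ported verbatim from the HodgeCMPerL package; no docstring in the source.) -/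
theorem jPadModel_fact_pull_H0 : jPadModel.Fact_pull_H0 := PadH0J.fact_pull_H0 toyModel_fact_pull_H0

/-- (Ported verbatim from the HodgeCMPerL package; no docstring in the source.) -/
theorem jPadModel_fact_cupAlg : jPadModel.Fact_cupAlg := PadH0.fact_cupAlg fact_cupAlg

/-- (Ported verbatim from the HodgeCMPerL package; no docstring in the source.) -/
theorem jPadModel_fact_cupAssoc : jPadModel.Fact_cupAssoc := PadH0.fact_cupAssoc (fact_cupAssoc exteriorHodgeData)

/-- (Ported verbatim from the HodgeCMPerL package; no docstring in the source.) -/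
theorem jPadModel_fact_dimProd : jPadModel.Fact_dimProd := PadH0.fact_dimProd_iff.mpr toyModel_fact_dimProd

/-- (Ported verbatim from the HodgeCMPerL package; no docstring in the source.) -/
theorem jPadModel_w_rk4 : jPadModel.W_RK4 := PadH0.w_RK4_iff.mpr toyModel_w_rk4

/-- (Ported verbatim from the HodgeCMPerL package; no docstring in the source.) -/
theorem jPadModel_pohlmannSpan : jPadModel.PohlmannSpan := PadH0J.pohlmannSpan toyModel_pohlmannSpan'

/-- (Ported verbatim from the HodgeCMPerL package; no docstring in the source.) -/
theorem jPadModel_hc_cm : jPadModel.HC_CM := PadH0J.hc_cm_iff.mpr toyModel_hc_cm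

/-- **N4 fails in `toyModel♭ᴶ`.** -/
theorem not_jPadModel_fact_hodge_F0 : ¬ jPadModel.Fact_hodge_F0 := by
  obtain ⟨F, n, Θ, h⟩ := toyModel_exists_cmProd_H0_nontrivial
  exact PadH0J.not_fact_hodge_F0 ⟨_, h⟩

/-- **M30 fails in `toyModel♭ᴶ`.** -/
theorem not_jPadModel_fact_weightHodge : ¬ jPadModel.Fact_weightHodge :=
  PadH0J.not_fact_weightHodge toyModel_fact_pull_H0 toyModel_exists_cmProd_H0_nontrivial

/-- The full profile of `toyModel♭ᴶ`. -/
theorem jPadModel_profile :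
    jPadModel.ModelAxioms ∧ jPadModel.Fact_dimProd ∧ jPadModel.Fact_cupExterior ∧ jPadModel.Fact_cup_hodge ∧
      jPadModel.Fact_pull_H0 ∧ jPadModel.Fact_cupAlg ∧ jPadModel.Fact_cupAssoc ∧ jPadModel.W_RK4 ∧
      jPadModel.PohlmannSpan ∧ jPadModel.HC_CM ∧ ¬ jPadModel.Fact_hodge_F0 ∧ ¬ jPadModel.Fact_weightHodge :=
  ⟨jPadModel_modelAxioms, jPadModel_fact_dimProd, jPadModel_fact_cupExterior, jPadModel_fact_cup_hodge,
    jPadModel_fact_pull_H0, jPadModel_fact_cupAlg, jPadModel_fact_cupAssoc, jPadModel_w_rk4, jPadModel_pohlmannSpan,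
    jPadModel_hc_cm, not_jPadModel_fact_hodge_F0, not_jPadModel_fact_weightHodge⟩

/-- **N4 `Fact_hodge_F0` is INDEPENDENT of `ModelAxioms ∧ N1 ∧ N2 ∧ N3 ∧ F4 ∧ F5 ∧ Fact_dimProd ∧ W_RK4 ∧ PohlmannSpan ∧
HC_CM`**: both truth values are realised (`toyModel`: true; `toyModel♭ᴶ`: false). -/
theorem fact_hodge_F0_independent :
    (∃ U : Universe, (U.ModelAxioms ∧ U.Fact_cupExterior ∧ U.Fact_cup_hodge ∧ U.Fact_pull_H0 ∧ U.Fact_cupAlg ∧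
      U.Fact_cupAssoc ∧ U.Fact_dimProd ∧ U.W_RK4 ∧ U.PohlmannSpan ∧ U.HC_CM) ∧ U.Fact_hodge_F0) ∧
    (∃ U : Universe, (U.ModelAxioms ∧ U.Fact_cupExterior ∧ U.Fact_cup_hodge ∧ U.Fact_pull_H0 ∧ U.Fact_cupAlg ∧
      U.Fact_cupAssoc ∧ U.Fact_dimProd ∧ U.W_RK4 ∧ U.PohlmannSpan ∧ U.HC_CM) ∧ ¬ U.Fact_hodge_F0) :=
  ⟨⟨toyModel, ⟨toyModel_modelAxioms, toyModel_fact_cupExterior, toyModel_fact_cup_hodge, toyModel_fact_pull_H0,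
      fact_cupAlg, fact_cupAssoc exteriorHodgeData, toyModel_fact_dimProd, toyModel_w_rk4, toyModel_pohlmannSpan',
      toyModel_hc_cm⟩, toyModel_fact_hodge_F0⟩,
    ⟨jPadModel, ⟨jPadModel_modelAxioms, jPadModel_fact_cupExterior, jPadModel_fact_cup_hodge, jPadModel_fact_pull_H0,
      jPadModel_fact_cupAlg, jPadModel_fact_cupAssoc, jPadModel_fact_dimProd, jPadModel_w_rk4, jPadModel_pohlmannSpan,
      jPadModel_hc_cm⟩, not_jPadModel_fact_hodge_F0⟩⟩

/-- **M30 `Fact_weightHodge` is not a consequence of `ModelAxioms ∧ N1 ∧ N2 ∧ N3 ∧ F4 ∧ F5 ∧ Fact_dimProd ∧ W_RK4 ∧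
PohlmannSpan ∧ HC_CM`** (so the hypothesis N4 of `weightHodge_of_facts` carries content). -/
theorem not_fact_weightHodge_of_others :
    ¬ ∀ U : Universe, U.ModelAxioms → U.Fact_cupExterior → U.Fact_cup_hodge → U.Fact_pull_H0 → U.Fact_cupAlg →
      U.Fact_cupAssoc → U.Fact_dimProd → U.W_RK4 → U.PohlmannSpan → U.HC_CM → U.Fact_weightHodge :=
  fun h => not_jPadModel_fact_weightHodge (h jPadModel jPadModel_modelAxioms jPadModel_fact_cupExterior
    jPadModel_fact_cup_hodge jPadModel_fact_pull_H0 jPadModel_fact_cupAlg jPadModel_fact_cupAssoc jPadModel_fact_dimProd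
    jPadModel_w_rk4 jPadModel_pohlmannSpan jPadModel_hc_cm)

/-- … in particular N4 is not a consequence of the other hypotheses of `pohlmannSpan_of_facts` and `Fact_dimProd`. -/
theorem not_fact_hodge_F0_of_others :
    ¬ ∀ U : Universe, U.ModelAxioms → U.Fact_cupExterior → U.Fact_cup_hodge → U.Fact_pull_H0 → U.Fact_dimProd →
      U.Fact_hodge_F0 :=
  fun h => not_jPadModel_fact_hodge_F0 (h jPadModel jPadModel_modelAxioms jPadModel_fact_cupExterior
    jPadModel_fact_cup_hodge jPadModel_fact_pull_H0 jPadModel_fact_dimProd)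

/-- `toyModel♭ᴶ` is a new model of the 28 facts (it differs from `toyModel` on N4). -/
theorem jPadModel_ne_toyModel : jPadModel ≠ toyModel := fun h => not_jPadModel_fact_hodge_F0 (h ▸ toyModel_fact_hodge_F0)


end HodgeCM.Toy

end
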